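import Summits.CriticalPhenomena.PercolationContinuityZ3.Theorems.PercGamblersRuinBGNOffTheFloorStructure
import Summits.CriticalPhenomena.PercolationContinuityZ3.Theorems.PercGamblersRuinBGNOffTheFloorLevelMono
import HarnessLib

/-!
# `BGNOffTheFloor` (stmt-CriticalPhenomena-7773) — the threshold structure of the climb family

Crux `Summit.CriticalPhenomena.PercolationContinuityZ3.Theses.PercGamblersRuin.BGNOffTheFloor`
(route `PercGamblersRuin`, item stmt-CriticalPhenomena-7773), line `registered` (birth skeleton
`Cruxes/BGNOffTheFloor/Lines/birth.lean`, lead c3). Support lemmas (`--supports`), all θ-blind and proved.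

Notation of the docstrings: `R(A) = {z : ℤ³ | -A < z₀}`, `E(A, L) = {ω | ∃ y, y₀ = L ∧ ω ∈ {0 ⟷ y in R(A)}}`
(the CLIMB EVENT: reach the level `L` above a floor at depth `A`), `e_n(a,b) = P_{p_c}(E(a n, b n))`,
`OffFloorAt a b :≡ ∀ ε > 0, ∃ᶠ n, e_n(a,b) < ε` (`liminf_n e_n(a,b) = 0`); the crux is
`∀ a < b, OffFloorAt a b`, its registered open stubs are `UnitRatioBGN :≡ ∃ b₀, ∀ ε > 0, ∃ᶠ m,
P_{p_c}(E(m, b₀ m)) < ε` and `ClimbExtension :≡ ∀ 1 ≤ a < b, OffFloorAt a (b+1) → OffFloorAt a b`.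

* `OffFloor.offFloor_of_ratio_lt` (= registered STUB 4 `stub_ratioMono` of the reshaped skeleton, lead c3) —
  **ratio monotonicity**: if `a'/b' < a/b` STRICTLY (`a' b < a b'`)
  then `OffFloorAt a b → OffFloorAt a' b'`. (For the scales `n` of the hypothesis take
  `n' = ⌊a n / a'⌋`: then `a' n' ≤ a n` and `b n ≤ b' n'` once `n ≥ a' b'`, and
  `E(a' n', b' n') ⊆ E(a n, b n)` a.s. by `OffFloor.climb_real_mono`.) So the set of ratios
  `a/b` at which `OffFloorAt` holds is a down-set of `ℚ ∩ (0,1]`, described by ONE number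
  `λ* = sup {a/b : OffFloorAt a b} ∈ [0, 1]`.
* `OffFloor.unitRatioBGN_iff_exists_pair` — the registered stub `UnitRatioBGN` is EXACTLY the
  existential shadow of the crux: `UnitRatioBGN ↔ ∃ a b, 1 ≤ a < b ∧ OffFloorAt a b` (`λ* > 0`).
  (`b₀ = 0` is impossible — the event is sure —, `b₀ = 1` is the diagonal, which forces
  `θ(p_c) = 0` by `OffFloor.theta_le_two_mul_climb_diag` and hence every pair.)
* `OffFloor.bgnOffTheFloor_iff_adjacent`, `OffFloor.bgnOffTheFloor_iff_cofinal` — the crux is the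
  family of ADJACENT pairs `(k, k+1)`, `k ≥ 1` (by `stub_levelMono`), a chain of ever stronger
  statements (`OffFloor.offFloor_adjacent_anti`), and it is equivalent to any cofinal subfamily
  (`λ* = 1`).
* `OffFloor.climbExtension_iff_unit_imp` — the registered stub `ClimbExtension` is EQUIVALENT to the
  implication `UnitRatioBGN → BGNOffTheFloor` (`λ* ∈ {0, 1}`): the registered split
  `BGNOffTheFloor ↔ UnitRatioBGN ∧ ClimbExtension` is of the shape `crux ↔ U ∧ (U → crux)`.
(The exit dichotomy `θ(p_c) ≤ P(E(A,L)) + P(E(L,A))` is in the sibling file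
`PercGamblersRuinBGNOffTheFloorExitDichotomy.lean`.)

References: G. Grimmett, *Percolation*, 2nd ed. (1999), Thm. (7.35); D. J. Barsky, G. R. Grimmett,
C. M. Newman, PTRF 90 (1991) 111–148.
-/

noncomputable section

namespace Summit.CriticalPhenomena.PercolationContinuityZ3.Theorems

open MeasureTheory Filter Literature.Probability.Percolation Literature.Probability.LatticeModels
open scoped Topology

namespace OffFloor

/-! ### Ratio monotonicity -/

/-- Arithmetic of the change of scale: for `a' b < a b'` and `n ≥ a' b' (N + 1)` there is a scale
`n' ≥ N` with `a' n' ≤ a n` and `b n ≤ b' n'`. [folklore] -/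
theorem exists_scale_of_ratio_lt {a b a' b' : ℕ} (hlt : a' * b < a * b') (N n : ℕ)
    (hn : a' * b' * (N + 1) ≤ n) :
    ∃ n' : ℕ, N ≤ n' ∧ a' * n' ≤ a * n ∧ b * n ≤ b' * n' := by
  have hb' : 1 ≤ b' := by
    rcases Nat.eq_zero_or_pos b' with h | h
    · subst h; simp at hlt
    · exact h
  have ha : 1 ≤ a := by
    rcases Nat.eq_zero_or_pos a with h | h
    · subst h; simp at hlt
    · exact h
  rcases Nat.eq_zero_or_pos a' with rfl | ha'
  · -- `a' = 0`: any large scale works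
    refine ⟨b * n + N, by omega, by simp, ?_⟩
    calc b * n ≤ b * n + N := Nat.le_add_right _ _
      _ = 1 * (b * n + N) := (one_mul _).symm
      _ ≤ b' * (b * n + N) := Nat.mul_le_mul_right _ hb'
  · refine ⟨a * n / a', ?_, Nat.mul_div_le (a * n) a', ?_⟩
    · -- `N ≤ a n / a'` since `a' N ≤ a' b' (N+1) ≤ n ≤ a n`
      refine (Nat.le_div_iff_mul_le ha').2 ?_
      have h1 : N ≤ b' * (N + 1) :=
        calc N ≤ N + 1 := N.le_succ
          _ = 1 * (N + 1) := (one_mul _).symm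
          _ ≤ b' * (N + 1) := Nat.mul_le_mul_right _ hb'
      calc N * a' = a' * N := mul_comm _ _
        _ ≤ a' * (b' * (N + 1)) := Nat.mul_le_mul_left _ h1
        _ = a' * b' * (N + 1) := by ring
        _ ≤ n := hn
        _ ≤ a * n := Nat.le_mul_of_pos_left n ha
    · set n' := a * n / a' with hn'
      have h2 : a * n < a' * (n' + 1) := Nat.lt_mul_div_succ (a * n) ha'
      -- multiply by `a' > 0` and compare monomials
      refine Nat.le_of_mul_le_mul_left (c := a') ?_ ha'
      have h3 : b' * (a * n + 1) ≤ b' * (a' * n' + a') := by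
        refine Nat.mul_le_mul_left _ ?_
        rw [Nat.mul_add_one] at h2
        omega
      have h4 : (a' * b + 1) * n ≤ (a * b') * n := Nat.mul_le_mul_right _ hlt
      have h5 : a' * b' ≤ n := le_trans (Nat.le_mul_of_pos_right _ (by omega)) hn
      nlinarith [h3, h4, h5]

/-- **Ratio monotonicity of `OffFloorAt`.** If `a' b < a b'` (i.e. `a'/b' < a/b` strictly) and
`liminf_n e_n(a,b) = 0`, then `liminf_n e_n(a',b') = 0`: along the scales `n` of the hypothesis,
the scale `n'` of `exists_scale_of_ratio_lt` has a deeper floor (`a' n' ≤ a n`) and a higher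
ceiling (`b' n' ≥ b n`), so `E(a' n', b' n') ⊆ E(a n, b n)` a.s. (`climb_real_mono`). [folklore] -/
theorem offFloor_of_ratio_lt {a b a' b' : ℕ} (hlt : a' * b < a * b')
    (h : ∀ ε : ℝ, 0 < ε → ∃ᶠ n : ℕ in atTop,
      (bondPercolation (zdGraph 3) (criticalProbI 3)).real
        {ω | ∃ y : Site 3, y 0 = ((b * n : ℕ) : ℤ) ∧
          ω ∈ openConnIn {z : Site 3 | -((a * n : ℕ) : ℤ) < z 0} 0 y} < ε) :
    ∀ ε : ℝ, 0 < ε → ∃ᶠ n : ℕ in atTop,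
      (bondPercolation (zdGraph 3) (criticalProbI 3)).real
        {ω | ∃ y : Site 3, y 0 = ((b' * n : ℕ) : ℤ) ∧
          ω ∈ openConnIn {z : Site 3 | -((a' * n : ℕ) : ℤ) < z 0} 0 y} < ε := by
  intro ε hε
  rw [frequently_atTop]
  intro N
  obtain ⟨n, hn, hnε⟩ := (frequently_atTop.1 (h ε hε)) (a' * b' * (N + 1))
  obtain ⟨n', hN, han, hbn⟩ := exists_scale_of_ratio_lt hlt N n hn
  refine ⟨n', hN, lt_of_le_of_lt ?_ hnε⟩
  refine climb_real_mono (criticalProbI 3) (A := ((a' * n' : ℕ) : ℤ)) (A' := ((a * n : ℕ) : ℤ))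
    (L := ((b * n : ℕ) : ℤ)) (L' := ((b' * n' : ℕ) : ℤ)) ?_ ?_ ?_
  · exact_mod_cast han
  · positivity
  · exact_mod_cast hbn

/-- The adjacent pairs form a chain: `OffFloorAt (k+1) (k+2) → OffFloorAt k (k+1)`
(`k/(k+1) < (k+1)/(k+2)`). [folklore] -/
theorem offFloor_adjacent_anti (k : ℕ)
    (h : ∀ ε : ℝ, 0 < ε → ∃ᶠ n : ℕ in atTop,
      (bondPercolation (zdGraph 3) (criticalProbI 3)).real
        {ω | ∃ y : Site 3, y 0 = (((k + 2) * n : ℕ) : ℤ) ∧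
          ω ∈ openConnIn {z : Site 3 | -(((k + 1) * n : ℕ) : ℤ) < z 0} 0 y} < ε) :
    ∀ ε : ℝ, 0 < ε → ∃ᶠ n : ℕ in atTop,
      (bondPercolation (zdGraph 3) (criticalProbI 3)).real
        {ω | ∃ y : Site 3, y 0 = (((k + 1) * n : ℕ) : ℤ) ∧
          ω ∈ openConnIn {z : Site 3 | -((k * n : ℕ) : ℤ) < z 0} 0 y} < ε :=
  offFloor_of_ratio_lt (by nlinarith) h

/-! ### Degenerate pairs -/

/-- For `a = 0` the climb event is EMPTY (the origin is not in `{z | 0 < z₀}`), so `OffFloorAt 0 b`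
holds vacuously. [folklore] -/
theorem climb_zero_left_eq_empty (L : ℤ) (n : ℕ) :
    {ω : BondConfig (Site 3) | ∃ y : Site 3, y 0 = L ∧
      ω ∈ openConnIn {z : Site 3 | -((0 * n : ℕ) : ℤ) < z 0} 0 y} = ∅ := by
  ext ω
  simp only [Set.mem_setOf_eq, Set.mem_empty_iff_false, iff_false, openConnIn]
  rintro ⟨y, -, hx, -, -⟩
  simp at hx

/-- `OffFloorAt 0 b` (vacuous). [folklore] -/
theorem offFloor_zero_left (b : ℕ) : ∀ ε : ℝ, 0 < ε → ∃ᶠ n : ℕ in atTop,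
    (bondPercolation (zdGraph 3) (criticalProbI 3)).real
      {ω | ∃ y : Site 3, y 0 = ((b * n : ℕ) : ℤ) ∧
        ω ∈ openConnIn {z : Site 3 | -((0 * n : ℕ) : ℤ) < z 0} 0 y} < ε := fun ε hε =>
  Frequently.of_forall fun n => by rw [climb_zero_left_eq_empty, measureReal_empty]; exact hε

/-- For the ceiling `L = 0` and a floor of depth `A ≥ 1` the climb event is SURE (witness `y = 0`).
[folklore] -/
theorem climb_level_zero_eq_univ {A : ℤ} (hA : 1 ≤ A) :
    {ω : BondConfig (Site 3) | ∃ y : Site 3, y 0 = 0 ∧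
      ω ∈ openConnIn {z : Site 3 | -A < z 0} 0 y} = Set.univ := by
  refine Set.eq_univ_of_forall fun ω => ⟨0, rfl, ?_⟩
  have h0 : (0 : Site 3) ∈ {z : Site 3 | -A < z 0} := by
    simp only [Set.mem_setOf_eq, Pi.zero_apply]; omega
  exact ⟨h0, h0, SimpleGraph.Reachable.refl _⟩

/-! ### `UnitRatioBGN` is the existential shadow of the crux -/

/-- **`UnitRatioBGN ↔ ∃` one non-degenerate pair.** The registered stub `stub_unitRatioBGN`
(`∃ b₀, liminf_m P_{p_c}(E(m, b₀ m)) = 0`) holds iff `OffFloorAt a b` holds for SOME pair with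
`1 ≤ a < b`. (`→`: `b₀ = 0` is impossible, the event being sure for `m ≥ 1`; `b₀ = 1` is the
diagonal, along which `liminf = 0` forces `θ(p_c) = 0` (`theta_le_two_mul_climb_diag`) and hence
every pair (`offFloor_of_theta_eq_zero`); `b₀ ≥ 2` is the pair `(1, b₀)`. `←`: ratio monotonicity
down to the pair `(1, b+1)`.) [folklore] -/
theorem unitRatioBGN_iff_exists_pair :
    (∃ b₀ : ℕ, ∀ ε : ℝ, 0 < ε → ∃ᶠ m : ℕ in atTop,
      (bondPercolation (zdGraph 3) (criticalProbI 3)).real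
        {ω | ∃ y : Site 3, y 0 = ((b₀ * m : ℕ) : ℤ) ∧
          ω ∈ openConnIn {z : Site 3 | -((m : ℕ) : ℤ) < z 0} 0 y} < ε) ↔
    ∃ a b : ℕ, 1 ≤ a ∧ a < b ∧ ∀ ε : ℝ, 0 < ε → ∃ᶠ n : ℕ in atTop,
      (bondPercolation (zdGraph 3) (criticalProbI 3)).real
        {ω | ∃ y : Site 3, y 0 = ((b * n : ℕ) : ℤ) ∧
          ω ∈ openConnIn {z : Site 3 | -((a * n : ℕ) : ℤ) < z 0} 0 y} < ε := by
  constructor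
  · rintro ⟨b₀, h⟩
    rcases Nat.lt_or_ge b₀ 2 with hb | hb
    · interval_cases b₀
      · -- `b₀ = 0`: the event is sure for `m ≥ 1`, contradiction
        exfalso
        obtain ⟨m, hlt, hm⟩ := ((h 1 one_pos).and_eventually (eventually_ge_atTop 1)).exists
        have huniv := climb_level_zero_eq_univ (A := ((m : ℕ) : ℤ)) (by exact_mod_cast hm)
        simp only [zero_mul, Nat.cast_zero] at hlt
        rw [huniv, probReal_univ] at hlt
        exact lt_irrefl _ hlt
      · -- `b₀ = 1`: the diagonal, `θ(p_c) = 0`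
        have hθ : theta (zdGraph 3) 0 (criticalProbI 3) = 0 := by
          refine le_antisymm (le_of_forall_pos_lt_add fun ε hε => ?_) measureReal_nonneg
          obtain ⟨n, hlt, hn⟩ := ((h (ε / 2) (by positivity)).and_eventually
            (eventually_ge_atTop 1)).exists
          have hdiag := theta_le_two_mul_climb_diag n hn
          simp only [one_mul] at hlt
          linarith
        exact ⟨1, 2, le_rfl, one_lt_two, offFloor_of_theta_eq_zero hθ 1 2 (by norm_num)⟩
    · refine ⟨1, b₀, le_rfl, hb, ?_⟩
      simpa only [one_mul] using h
  · rintro ⟨a, b, ha, hab, h⟩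
    refine ⟨b + 1, ?_⟩
    have key := offFloor_of_ratio_lt (a := a) (b := b) (a' := 1) (b' := b + 1) (by nlinarith) h
    simpa only [one_mul] using key

/-! ### The crux is the family of adjacent pairs -/

/-- **`BGNOffTheFloor ↔` all adjacent pairs `(k, k+1)`, `k ≥ 1`** (`a = 0` is vacuous; for
`1 ≤ a < b` use the pair `(a, a+1)` and ceiling monotonicity `stub_levelMono`). [folklore] -/
theorem bgnOffTheFloor_iff_adjacent :
    Theses.PercGamblersRuin.BGNOffTheFloor ↔ ∀ k : ℕ, 1 ≤ k → ∀ ε : ℝ, 0 < ε → ∃ᶠ n : ℕ in atTop,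
      (bondPercolation (zdGraph 3) (criticalProbI 3)).real
        {ω | ∃ y : Site 3, y 0 = (((k + 1) * n : ℕ) : ℤ) ∧
          ω ∈ openConnIn {z : Site 3 | -((k * n : ℕ) : ℤ) < z 0} 0 y} < ε := by
  constructor
  · exact fun h k _ => h k (k + 1) (Nat.lt_succ_self k)
  · intro h a b hab
    rcases Nat.eq_zero_or_pos a with rfl | ha
    · exact offFloor_zero_left b
    · intro ε hε
      exact (h a ha ε hε).mono fun n hn =>
        lt_of_le_of_lt (stub_levelMono a (a + 1) b n (by omega)) hn

/-- **`BGNOffTheFloor ↔` a COFINAL family of adjacent pairs** (`λ* = 1`): it suffices that for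
every `K` some adjacent pair `(k, k+1)` with `k ≥ K` is off the floor (ratio monotonicity:
`a/b < k/(k+1)` as soon as `b ≥ a + 1` and `k > a`). [folklore] -/
theorem bgnOffTheFloor_iff_cofinal :
    Theses.PercGamblersRuin.BGNOffTheFloor ↔ ∀ K : ℕ, ∃ k : ℕ, K ≤ k ∧ ∀ ε : ℝ, 0 < ε →
      ∃ᶠ n : ℕ in atTop, (bondPercolation (zdGraph 3) (criticalProbI 3)).real
        {ω | ∃ y : Site 3, y 0 = (((k + 1) * n : ℕ) : ℤ) ∧
          ω ∈ openConnIn {z : Site 3 | -((k * n : ℕ) : ℤ) < z 0} 0 y} < ε := by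
  rw [bgnOffTheFloor_iff_adjacent]
  constructor
  · exact fun h K => ⟨K + 1, by omega, h (K + 1) (by omega)⟩
  · intro h a ha
    obtain ⟨k, hk, hoff⟩ := h (a + 1)
    exact offFloor_of_ratio_lt (by nlinarith) hoff

/-! ### `ClimbExtension` is the implication `UnitRatioBGN → BGNOffTheFloor` -/

/-- **`ClimbExtension ↔ (UnitRatioBGN → BGNOffTheFloor)`.** `→`: given `UnitRatioBGN`, some pair
`(1, B)` is off the floor (`unitRatioBGN_iff_exists_pair` and ratio monotonicity), hence every
pair of ratio `< 1/B`; for `1 ≤ a < b` start from the ceiling `a B + b` (ratio `< 1/B`) and lower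
it one unit at a time with `ClimbExtension`. `←`: the hypothesis `OffFloorAt a (b+1)` of
`ClimbExtension` is itself a witness of `UnitRatioBGN`, so the crux holds, in particular at
`(a, b)`. Consequently the registered split `BGNOffTheFloor ↔ UnitRatioBGN ∧ ClimbExtension` has
the shape `crux ↔ U ∧ (U → crux)` with `U` the existential shadow of the crux. [folklore] -/
theorem climbExtension_iff_unit_imp :
    (∀ a b : ℕ, 1 ≤ a → a < b →
      (∀ ε : ℝ, 0 < ε → ∃ᶠ n : ℕ in atTop,
        (bondPercolation (zdGraph 3) (criticalProbI 3)).real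
          {ω | ∃ y : Site 3, y 0 = (((b + 1) * n : ℕ) : ℤ) ∧
            ω ∈ openConnIn {z : Site 3 | -((a * n : ℕ) : ℤ) < z 0} 0 y} < ε) →
      ∀ ε : ℝ, 0 < ε → ∃ᶠ n : ℕ in atTop,
        (bondPercolation (zdGraph 3) (criticalProbI 3)).real
          {ω | ∃ y : Site 3, y 0 = ((b * n : ℕ) : ℤ) ∧
            ω ∈ openConnIn {z : Site 3 | -((a * n : ℕ) : ℤ) < z 0} 0 y} < ε) ↔
    ((∃ b₀ : ℕ, ∀ ε : ℝ, 0 < ε → ∃ᶠ m : ℕ in atTop,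
      (bondPercolation (zdGraph 3) (criticalProbI 3)).real
        {ω | ∃ y : Site 3, y 0 = ((b₀ * m : ℕ) : ℤ) ∧
          ω ∈ openConnIn {z : Site 3 | -((m : ℕ) : ℤ) < z 0} 0 y} < ε) →
      Theses.PercGamblersRuin.BGNOffTheFloor) := by
  constructor
  · intro hext hunit a b hab
    rcases Nat.eq_zero_or_pos a with rfl | ha
    · exact offFloor_zero_left b
    · -- a pair `(a₁, b₁)` off the floor, from `UnitRatioBGN`
      obtain ⟨a₁, b₁, ha₁, -, hoff⟩ := unitRatioBGN_iff_exists_pair.1 hunit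
      -- base: every ceiling `b' ≥ a b₁ + 1` above the floor `a` has ratio `a/b' < a₁/b₁`
      have hbase : ∀ b' : ℕ, a * b₁ + 1 ≤ b' → ∀ ε : ℝ, 0 < ε → ∃ᶠ n : ℕ in atTop,
          (bondPercolation (zdGraph 3) (criticalProbI 3)).real
            {ω | ∃ y : Site 3, y 0 = ((b' * n : ℕ) : ℤ) ∧
              ω ∈ openConnIn {z : Site 3 | -((a * n : ℕ) : ℤ) < z 0} 0 y} < ε :=
        fun b' hb' => offFloor_of_ratio_lt (by nlinarith) hoff
      -- downward induction on the ceiling, one unit at a time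
      have hdown : ∀ j b' : ℕ, a < b' → a * b₁ + 1 ≤ b' + j → ∀ ε : ℝ, 0 < ε →
          ∃ᶠ n : ℕ in atTop, (bondPercolation (zdGraph 3) (criticalProbI 3)).real
            {ω | ∃ y : Site 3, y 0 = ((b' * n : ℕ) : ℤ) ∧
              ω ∈ openConnIn {z : Site 3 | -((a * n : ℕ) : ℤ) < z 0} 0 y} < ε := by
        intro j
        induction j with
        | zero => exact fun b' _ hj => hbase b' (by simpa using hj)
        | succ j ih =>
            exact fun b' hb' hj => hext a b' ha hb' (ih (b' + 1) (by omega) (by omega))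
      exact hdown (a * b₁ + 1) b hab (by omega)
  · intro h a b ha hab hyp
    have hunit := unitRatioBGN_iff_exists_pair.2 ⟨a, b + 1, ha, by omega, hyp⟩
    exact h hunit a b hab

end OffFloor

/-- **STUB 4 of line `registered` (birth) of `BGNOffTheFloor` (`RatioMono`), registered signature
verbatim.** Ratio monotonicity of `OffFloorAt`: for `a' b < a b'` (i.e. `a'/b' < a/b` strictly),
`liminf_n P_{p_c}(E(a n, b n)) = 0 → liminf_n P_{p_c}(E(a' n, b' n)) = 0`, by
`OffFloor.offFloor_of_ratio_lt` (change of scale `n' = ⌊a n / a'⌋` and the two monotonicities of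
the climb event). [folklore] -/
theorem stub_ratioMono : ∀ a b a' b' : ℕ, a' * b < a * b' →
    (∀ ε : ℝ, 0 < ε → ∃ᶠ n : ℕ in atTop,
      (bondPercolation (zdGraph 3) (criticalProbI 3)).real
        {ω | ∃ y : Site 3, y 0 = ((b * n : ℕ) : ℤ) ∧
          ω ∈ openConnIn {z : Site 3 | -((a * n : ℕ) : ℤ) < z 0} 0 y} < ε) →
    ∀ ε : ℝ, 0 < ε → ∃ᶠ n : ℕ in atTop,
      (bondPercolation (zdGraph 3) (criticalProbI 3)).real
        {ω | ∃ y : Site 3, y 0 = ((b' * n : ℕ) : ℤ) ∧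
          ω ∈ openConnIn {z : Site 3 | -((a' * n : ℕ) : ℤ) < z 0} 0 y} < ε :=
  fun _ _ _ _ hlt h => OffFloor.offFloor_of_ratio_lt hlt h

end Summit.CriticalPhenomena.PercolationContinuityZ3.Theorems

end
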